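import Mathlib
import HarnessLib
import HarnessLib.Audit
import Summits.SmoothPoincare4.Statement
import Literature.Topology.FourManifolds.Knots
import Literature.Geometry.Lorentzian.PseudoRiemannianMetric
import Literature.Geometry.Lorentzian.LeviCivita
import Literature.Geometry.Lorentzian.Geodesic
import Literature.Geometry.Riemannian.ConstantCurvature
import HarnessLib.Audit.Status.Attr

/-!
Route: HyperbolicTorusFillings

DORMANT since 2026-08-22T23:32:15Z (reconciler: no traction for 5.7 d (last activity item-evidence-added at 2026-08-17T04:51:23Z); parked, not closed — `ledger route dormant route-SmoothPoincare4-HyperbolicTorusFillings --off` to reacti) — unstaffed, not closed; items shared with open routes are served there. `ledger route dormant <id> --off` reactivates.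

Route HyperbolicTorusFillings — realises idea card
SmoothPoincare4/SmoothPoincare4/hyperbolic-torus-fillings ("A four-dimensional Property P: torus
surgery in S^4, hyperbolic Dehn filling, and the finiteness of fake-S^4 fillings of a Mostow-rigid
exterior"). Positive side.
It suffices to show X = G ∧ P (SPC4 in torus-surgery = four-dimensional Dehn-surgery coordinates):
 G (item SingleLinkGeneration; Larson's Question 1 restricted to homotopy spheres): every smooth
homotopy 4-sphere M is ONE simultaneous torus surgery (logarithmic transformation) on a framed link
of tori T_1,…,T_n ⊂ S⁴ with regluing matrices A_i ∈ GL(3,ℤ);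
 P (item LinkSurgeryPropertyP; "4D Property P, link form"): every torus surgery on a framed link of
tori in S⁴ whose result is homotopy equivalent to S⁴ is diffeomorphic to S⁴.
The card's mechanism is crux rank 2 (HyperbolicFillingsStandard = P on the Mostow-rigid stratum):
when S⁴ ∖ ∪T_i is complete hyperbolic (Ivanšić's five tori; the Ivanšić–Ratcliffe–Tschantz double
covers of Ratcliffe–Tschantz census manifolds) the 2π theorem makes all-long fillings non-positively
curved, hence never simply connected, so fake-S⁴ candidates of hyperbolic origin are SHORT fillings
of a rigid exterior with a canonical Kirby diagram — a certifiable census whose first rows (IRT 2005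
Thm 4.4: homeomorphic to S⁴, smooth type open except M~1011, Saratchandran 2015) are in print.
The torus-link-surgery predicate TLS(M,n,T,A) is INLINED over existing declarations after the
pattern of Literature.Topology.FourManifolds.IsIntegralSurgeryLink (framed tubes T_i : (S¹×S¹)×ℝ² ↪
S⁴ pairwise disjoint; U = complement of the core tori as TopologicalSpace.Opens S⁴; open smooth
embeddings jA : U → M, jB_i : (S¹×S¹)×ℝ² → M jointly covering M with disjoint jB-images; fibre
relation jA a = jB_i b ↔ a = T_i(ψ_(A_i) b), ψ_A the linear GL(3,ℤ) regluing of T³×(0,∞) written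
with Literature.Topology.FourManifolds.circlePoint); elaborated rc 0 (folder/Sketch.lean, with
`assembly_provable : Assembly` and `hyp_of_propertyP : LinkSurgeryPropertyP →
HyperbolicFillingsStandard` as sanity theorems).
Lean: `(∀ (M : Type) [TopologicalSpace M] [T2Space M] [SecondCountableTopology M] [ChartedSpace
(EuclideanSpace ℝ (Fin 4)) M] [IsManifold (𝓡 4) ∞ M], ContinuousMap.HomotopyEquiv M ↥(Metric.sphere
(0 : EuclideanSpace ℝ (Fin 5)) 1) → ∃ (n : ℕ) (T : Fin n → (↥(Metric.sphere (0 : EuclideanSpace ℝ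
(Fin 2)) 1) × ↥(Metric.sphere (0 : EuclideanSpace ℝ (Fin 2)) 1)) × EuclideanSpace ℝ (Fin 2) →
↥(Metric.sphere (0 : EuclideanSpace ℝ (Fin 5)) 1)) (A : Fin n → Matrix (Fin 3) (Fin 3) ℤ), (∀ i,
Manifold.IsSmoothEmbedding (((𝓡 1).prod (𝓡 1)).prod 𝓘(ℝ, EuclideanSpace ℝ (Fin 2))) (𝓡 4) ∞ (T i)) ∧
Pairwise (fun i j => Disjoint (Set.range (T i)) (Set.range (T j))) ∧ (∀ i, (A i).det = 1 ∨ (A i).det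
= -1) ∧ ∃ (U : TopologicalSpace.Opens ↥(Metric.sphere (0 : EuclideanSpace ℝ (Fin 5)) 1)) (jA : ↥U →
M) (jB : Fin n → (↥(Metric.sphere (0 : EuclideanSpace ℝ (Fin 2)) 1) × ↥(Metric.sphere (0 :
EuclideanSpace ℝ (Fin 2)) 1)) × EuclideanSpace ℝ (Fin 2) → M), (U : Set ↥(Metric.sphere (0 :
EuclideanSpace ℝ (Fin 5)) 1)) = (⋃ i, Set.range (fun x : (↥(Metric.sphere (0 : EuclideanSpace ℝ (Fin
2)) 1) × ↥(Metric.sphere (0 : EuclideanSpace ℝ (Fin 2)) 1)) => T i (x, 0)))ᶜ ∧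
Manifold.IsSmoothEmbedding (𝓡 4) (𝓡 4) ∞ jA ∧ IsOpen (Set.range jA) ∧ (∀ i,
Manifold.IsSmoothEmbedding (((𝓡 1).prod (𝓡 1)).prod 𝓘(ℝ, EuclideanSpace ℝ (Fin 2))) (𝓡 4) ∞ (jB i) ∧
IsOpen (Set.range (jB i))) ∧ Set.range jA ∪ (⋃ i, Set.range (jB i)) = Set.univ ∧ Pairwise (fun i j
=> Disjoint (Set.range (jB i)) (Set.range (jB j))) ∧ ∀ (i : Fin n) (a : ↥U) (b : (↥(Metric.sphere (0
: EuclideanSpace ℝ (Fin 2)) 1) × ↥(Metric.sphere (0 : EuclideanSpace ℝ (Fin 2)) 1)) × EuclideanSpace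
ℝ (Fin 2)), (jA a = jB i b ↔ ∃ θ₁ θ₂ θ₃ t : ℝ, 0 < t ∧ b =
((Literature.Topology.FourManifolds.circlePoint (θ₁), Literature.Topology.FourManifolds.circlePoint
(θ₂)), t • ((Literature.Topology.FourManifolds.circlePoint (θ₃) : ↥(Metric.sphere (0 :
EuclideanSpace ℝ (Fin 2)) 1)) : EuclideanSpace ℝ (Fin 2))) ∧ (a : ↥(Metric.sphere (0 :
EuclideanSpace ℝ (Fin 5)) 1)) = T i ((Literature.Topology.FourManifolds.circlePoint ((A i 0 0 : ℝ) *
θ₁ + (A i 0 1 : ℝ) * θ₂ + (A i 0 2 : ℝ) * θ₃), Literature.Topology.FourManifolds.circlePoint ((A i 1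
0 : ℝ) * θ₁ + (A i 1 1 : ℝ) * θ₂ + (A i 1 2 : ℝ) * θ₃)), t •
((Literature.Topology.FourManifolds.circlePoint ((A i 2 0 : ℝ) * θ₁ + (A i 2 1 : ℝ) * θ₂ + (A i 2 2
: ℝ) * θ₃) : ↥(Metric.sphere (0 : EuclideanSpace ℝ (Fin 2)) 1)) : EuclideanSpace ℝ (Fin 2))))) ∧ (∀
(M : Type) [TopologicalSpace M] [T2Space M] [SecondCountableTopology M] [ChartedSpace
(EuclideanSpace ℝ (Fin 4)) M] [IsManifold (𝓡 4) ∞ M] (n : ℕ) (T : Fin n → (↥(Metric.sphere (0 :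
EuclideanSpace ℝ (Fin 2)) 1) × ↥(Metric.sphere (0 : EuclideanSpace ℝ (Fin 2)) 1)) × EuclideanSpace ℝ
(Fin 2) → ↥(Metric.sphere (0 : EuclideanSpace ℝ (Fin 5)) 1)) (A : Fin n → Matrix (Fin 3) (Fin 3) ℤ),
((∀ i, Manifold.IsSmoothEmbedding (((𝓡 1).prod (𝓡 1)).prod 𝓘(ℝ, EuclideanSpace ℝ (Fin 2))) (𝓡 4) ∞
(T i)) ∧ Pairwise (fun i j => Disjoint (Set.range (T i)) (Set.range (T j))) ∧ (∀ i, (A i).det = 1 ∨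
(A i).det = -1) ∧ ∃ (U : TopologicalSpace.Opens ↥(Metric.sphere (0 : EuclideanSpace ℝ (Fin 5)) 1))
(jA : ↥U → M) (jB : Fin n → (↥(Metric.sphere (0 : EuclideanSpace ℝ (Fin 2)) 1) × ↥(Metric.sphere (0
: EuclideanSpace ℝ (Fin 2)) 1)) × EuclideanSpace ℝ (Fin 2) → M), (U : Set ↥(Metric.sphere (0 :
EuclideanSpace ℝ (Fin 5)) 1)) = (⋃ i, Set.range (fun x : (↥(Metric.sphere (0 : EuclideanSpace ℝ (Fin
2)) 1) × ↥(Metric.sphere (0 : EuclideanSpace ℝ (Fin 2)) 1)) => T i (x, 0)))ᶜ ∧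
Manifold.IsSmoothEmbedding (𝓡 4) (𝓡 4) ∞ jA ∧ IsOpen (Set.range jA) ∧ (∀ i,
Manifold.IsSmoothEmbedding (((𝓡 1).prod (𝓡 1)).prod 𝓘(ℝ, EuclideanSpace ℝ (Fin 2))) (𝓡 4) ∞ (jB i) ∧
IsOpen (Set.range (jB i))) ∧ Set.range jA ∪ (⋃ i, Set.range (jB i)) = Set.univ ∧ Pairwise (fun i j
=> Disjoint (Set.range (jB i)) (Set.range (jB j))) ∧ ∀ (i : Fin n) (a : ↥U) (b : (↥(Metric.sphere (0
: EuclideanSpace ℝ (Fin 2)) 1) × ↥(Metric.sphere (0 : EuclideanSpace ℝ (Fin 2)) 1)) × EuclideanSpace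
ℝ (Fin 2)), (jA a = jB i b ↔ ∃ θ₁ θ₂ θ₃ t : ℝ, 0 < t ∧ b =
((Literature.Topology.FourManifolds.circlePoint (θ₁), Literature.Topology.FourManifolds.circlePoint
(θ₂)), t • ((Literature.Topology.FourManifolds.circlePoint (θ₃) : ↥(Metric.sphere (0 :
EuclideanSpace ℝ (Fin 2)) 1)) : EuclideanSpace ℝ (Fin 2))) ∧ (a : ↥(Metric.sphere (0 :
EuclideanSpace ℝ (Fin 5)) 1)) = T i ((Literature.Topology.FourManifolds.circlePoint ((A i 0 0 : ℝ) *
θ₁ + (A i 0 1 : ℝ) * θ₂ + (A i 0 2 : ℝ) * θ₃), Literature.Topology.FourManifolds.circlePoint ((A i 1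
0 : ℝ) * θ₁ + (A i 1 1 : ℝ) * θ₂ + (A i 1 2 : ℝ) * θ₃)), t •
((Literature.Topology.FourManifolds.circlePoint ((A i 2 0 : ℝ) * θ₁ + (A i 2 1 : ℝ) * θ₂ + (A i 2 2
: ℝ) * θ₃) : ↥(Metric.sphere (0 : EuclideanSpace ℝ (Fin 2)) 1)) : EuclideanSpace ℝ (Fin 2))))) →
ContinuousMap.HomotopyEquiv M ↥(Metric.sphere (0 : EuclideanSpace ℝ (Fin 5)) 1) → Nonempty (M ≃ₘ⟮𝓡
4, 𝓡 4⟯ ↥(Metric.sphere (0 : EuclideanSpace ℝ (Fin 5)) 1)))`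
## Assembly
G → P → SmoothPoincare4, pure logic: given M ≃ₕ S⁴ with its atlas, G presents M as TLS(M,n,T,A), P
returns Nonempty (M ≃ₘ S⁴); SmoothPoincare4 unfolds to exactly these binders (universe 0).

Rationale: WHY THIS LINE. Torus surgery is the 4-dimensional Dehn surgery: it preserves (χ,σ), contains the
Gluck twists (Iwase 1988, doi:10.2140/pjm.1988.133.289) and, by Baykur–Sunukjian (arXiv:1009.0514;
recalled in Larson arXiv:1502.06834 §1), reaches every homotopy 4-sphere from S⁴ by a SEQUENCE of
surgeries; Larson's Question 1 asks for a single link. The 3-dimensional template 'generation +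
Property P + hyperbolic Dehn filling' transplants with an explicit dictionary: knot exterior ↦
torus-link exterior with T³ cusps; Thurston's cofinite filling ↦ the 2π/NPC filling theorem in every
dimension (Anderson math/0303260 §2.1; Ratcliffe–Tschantz math/0312436 §2; Fujiwara–Manning CAT(0)
fillings); exceptional slope ↦ short slope; Gordon–Luecke/Kronheimer–Mrowka ↦ crux P. Imported area:
hyperbolic geometry / geometric group theory — Mostow rigidity gives canonical coordinates (slopes
in a rigid exterior), relatively hyperbolic Dehn filling (Osin, Groves–Manning) is the algebraic
shadow; plus certified computation (short-slope census of the Ratcliffe–Tschantz census manifolds: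
coset enumeration for π₁ = 1, Kirby calculus per candidate on Saratchandran's diagrams
arXiv:1503.06722/1503.07778). No prior route touches torus surgery; negatives index empty.
RANKED CRUXES. #2 HyperbolicFillingsStandard — P for links whose complement is complete hyperbolic;
most informative because its open instances are explicit (Ivanšić–Ratcliffe–Tschantz math/0502293
Thm 4.4, Rem 4.5, Ex 4.8: simply connected fillings homeomorphic to S⁴, smooth type open;
Saratchandran arXiv:1503.07778: the canonical filling of M~1011 is standard) (why it might fail: an
IRT filling is exotic = ¬SPC4, or the simply connected fillings form infinite slabs — one short
slope, the others free — with no uniform diagram argument; sources math/0502293, arXiv:1503.07778,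
math/0312436). #3 SingleLinkGeneration — Larson 2018 Question 1 for homotopy spheres (why it might
fail: Baykur–Sunukjian sequences may be essential, a later torus meeting an earlier core torus with
non-zero algebraic intersection; sources arXiv:1502.06834 §1 Q1, arXiv:1009.0514). #4
LinkSurgeryPropertyP — the umbrella, containing the Gluck twist conjecture (Iwase) and every IRT
candidate (why it might fail: one exotic link surgery refutes it and SPC4; no engine off the
hyperbolic and S¹-symmetric strata; sources arXiv:1502.06834, doi:10.2140/pjm.1988.133.289).
KILL CRITERIA. (i) A theorem that some homotopy 4-sphere is not a single-link torus surgery on S⁴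
refutes G: close --reason refuted:SingleLinkGeneration (P survives only as a conjunct of independent
interest, to be re-homed). (ii) An exotic simply connected filling of a hyperbolic exterior refutes
P, rank 2 and SPC4: the route flips to its negative support item HyperbolicOriginExotic. (iii) A
refuter showing the inlined TLS predicate admits degenerate witnesses that are not torus surgeries
forces a restate through the definition request IsTorusLinkSurgery before any staffing. (iv)
GluckLasagna's GlasThesis proved (an exotic Gluck twist) refutes P via Iwase.
NOT DECOMPOSED YET. The regime split of P (hyperbolic | S¹-symmetric/spun | rest) is not glued —
dimension 4 has no geometrisation — so only the hyperbolic stratum is filed (rank 2) and the spun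
stratum as support; the uniform bound on short slopes per T³ cusp (4D '6-theorem' via cusp-volume
bounds à la Kellerhals), the recursion after a first short filling, and the explicit census of R–T
manifolds are prover/refuter work under rank 2; finite volume is omitted from the typed hyperbolic
hypothesis (the tree has no Riemannian volume; for π₁-injective T³ ends completeness forces rank-3
cusps) — harmless because every positive crux here is implied by SPC4.
CHEAPEST FALSIFIER. For the supply: run IRT's own recipe (math/0502293 §4, Table 2) with GAP on the
R–T presentations — enumerate fillings of M~1011 and its sister double covers with slope coordinates
|b_i|,|c_i| ≤ 2 and coset-enumerate π₁; if every simply connected filling is the canonical one up to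
the symmetry group, rank 2 has no candidate beyond Saratchandran's theorem and the line shrinks to G
∧ P without its engine. For G: check Larson §4 (round cobordisms) and Baykur–Sunukjian §3 for an
explicit homotopy sphere needing two rounds. Degenerate-witness test of TLS already run in
Sketch.lean: n = 0 forces M ≅ S⁴ (consistent: S⁴ is the empty surgery).
TWO-LAYER PLAN. Foreseen splits (not filed): HyperbolicFillingsStandard ⇐ (ShortSlopeCensusFinite:
per hyperbolic exterior and cusp, finitely many slopes of length ≤ 2π on the maximal cusp torus,
computable) → (ShortFillingsStandard: each simply connected short filling of an IRT exterior is S⁴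
by handle calculus) → HyperbolicFillingsStandard, glue = LongFillingsNotSimplyConnected;
SingleLinkGeneration ⇐ (B–S sequence of length 2 ⇒ single link after isotopy when algebraic
intersections vanish) → (intersections can be made to vanish for homotopy spheres).
DEFINITION REQUESTS. IsTorusLinkSurgery (Literature/Topology/FourManifolds; replaces the inlined TLS
block); a complete finite-volume hyperbolic metric predicate with cusp cross-sections and slope
length (Literature/Geometry/Riemannian) for the 2π support item. Cite facts wanted: Baykur–Sunukjian
generation theorem; Iwase 'Gluck twist = torus surgery'; Anderson/Fujiwara–Manning 2π-CAT(0) filling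
theorem; IRT Thm 4.4.
SUPPORT. HyperbolicOriginExotic = ¬HyperbolicFillingsStandard (typed; the negative side/census
supply, bound by the invariant barriers); LongFillingsNotSimplyConnected (2π consequence, informal
until the metric notions land); SpunTorusSurgeries (Property P for spun and twisted-spun tori T_K,
T'_K: Larson §3, Iwase; S¹-equivariant cases by Fintushel–Pao).
DEGENERATE CASES CHECKED. n = 0 in TLS gives exactly M ≅ S⁴; det A_i = ±1 makes ψ_A a
self-diffeomorphism of T³×(0,∞), so the fibre relation is the graph of an open embedding with closed
graph (Hausdorff pushout); the surgery depends only on the third column (a,b,p) of A_i (Larson §2),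
all of GL(3,ℤ) is allowed; framings are absorbed into T_i.

Novelty: NOVELTY (searched 2026-08-15 before claiming: lit read arXiv:1502.06834 pp.2-3,5-6,9-11;
arXiv:math/0312436 pp.4-9; arXiv:1503.07778 pp.3-4; arXiv:math/0502293 pp.9-10,13; zbMATH 'torus
surgery 4-sphere' (9 rows: Iwase 1988, Larson 2018, Suzuki 2023 pochette surgery arXiv:2205.05239,
Meier–Zupan arXiv:1904.08527, Kim–Yamada arXiv:1707.03860 …), 'hyperbolic link complement 4-sphere
tori' (Saratchandran NYJM 24 (2018) zbl:1404.57035), 'Dehn filling hyperbolic 4-manifolds'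
(Martelli–Riolo arXiv:1608.08309, Kerckhoff–Storm arXiv:0805.4537, Martelli math/0412511); OpenAlex
budget exhausted, galaxy saturated (>90 s queue) this session; card-level audit by
refuter-novelty-audit-…-14-0 graded NEW-COMBINATION with priors arXiv:1503.07778, arXiv:1503.06722,
zbl:1404.57035, math/0312436, math/0502293).
Nearest prior art: Larson 2018 (doi:10.1017/s0305004116000876) frames torus surgery in S⁴ as 4D Dehn
surgery and asks Question 1 (= crux SingleLinkGeneration without the restriction to homotopy
spheres) — no Property-P/SPC4 statement; Ratcliffe–Tschantz 2005 (doi:10.1016/j.top.2004.10.006) use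
the 2π theorem on Ivanšić's exterior to harvest LONG fillings (aspherical homology spheres) and
discard the short ones; Ivanšić–Ratcliffe–Tschantz 2005 (doi:10.2140/agt.2005.5.999, Thm 4.4/Rem
4.5) produce simply connected fillings homeomorphic to S⁴ and leave the smooth type open;
Saratchandran 2015 (arXiv:1503.07778) settles ONE filling by Kirby calculus; Martelli–Riolo 2018 do
hyperbolic Dehn fil  [refs: 10.1017/s0305004116000876, 10.1016/j.top.2004.10.006, 10.2140/agt.2005.5.999, 1502.06834, math/0312436, 1503.07778, math/0502293, 2205.05239, 1904.08527, 1707.03860, 1608.08309, 0805.4537, 1503.06722, doi:10.1017/s0305004116000876, doi:10.1016/j.top.2004.10.006, doi:10.2140/agt.2005.5.999]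

Barriers (technique_class: hyperbolic-Dehn-filling, torus-surgery, geometric-finiteness): - technique_class: hyperbolic-Dehn-filling, torus-surgery, geometric-finiteness
- Literature.Barriers.SmoothPoincare4.CircleActionBarrierFour: used POSITIVELY — spun tori and
S¹-equivariant surgeries inherit a circle action and are standard by Fintushel–Pao (support
SpunTorusSurgeries); it predicts that candidates live on the hyperbolic stratum (Mostow: finite
isometry groups, no S¹), which is where rank 2 looks.
- Literature.Barriers.SmoothPoincare4.CappellShanesonFamilyBarrier: CS spheres are torus-bundle
(Sol/Euclidean monodromy) constructions, not fillings of hyperbolic exteriors; the barrier's lesson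
(families die to handle tricks) is the expected and DESIRED fate of individual short fillings on the
positive side (Saratchandran's standardisation of one filling is the first instance).
- Literature.Barriers.SmoothPoincare4.HCobordismBarrierFour: evaded — no h-cobordism step;
standardness per filling is by explicit handle calculus on the canonical 24-cell Kirby diagram.
- Literature.Barriers.SmoothPoincare4.GaugeSumBarrierFour: binds only the negative support item
HyperbolicOriginExotic (a candidate needs an unstable detector); the positive cruxes evaluate no
invariant of Σ.
- Literature.Barriers.SmoothPoincare4.TopologicalBarrierFour: same — negative side only; all
fillings in rank 2 are already known homeomorphic to S⁴ (Freedman), the question is smooth.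
- Literature.Barriers.SmoothPoincare4.StableBarrierFour: negative side only; whether
hyperbolic-origin fillings dissolv

History (route lifecycle, newest last):
- 2026-08-22T23:32:15Z · DORMANT — reconciler: no traction for 5.7 d (last activity item-evidence-added at 2026-08-17T04:51:23Z); parked, not closed — `ledger route dormant route-SmoothPoincare4- (operator:999:3639716)

sub-problem: SmoothPoincare4 · status: dormant · opened planner-plancard-SmoothPoincare4-SmoothPoinca-c7375082-0 2026-08-15T11:17:06Z · rev 1 · ledger route-SmoothPoincare4-HyperbolicTorusFillings
GENERATED by the gate from the ledger (D-0016/17). Provers cite these decls: `theorem foo : Summit.SmoothPoincare4.SmoothPoincare4.Theses.HyperbolicTorusFillings.<Decl> := …` in Summits/SmoothPoincare4/SmoothPoincare4/Theorems/<Name>.lean.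
-/

namespace Summit.SmoothPoincare4.SmoothPoincare4.Theses.HyperbolicTorusFillings

open scoped BigOperators Topology Manifold Classical MeasureTheory ProbabilityTheory Matrix InnerProductSpace ComplexConjugate ContinuousMap ContDiff
open Filter Set Function TopologicalSpace MeasureTheory

attribute [summit_statement] _root_.SmoothPoincare4

open Literature.SPC4

/-- item stmt-SmoothPoincare4-3357 · crux · rank 2 · open · by planner
why it might fail: One IRT filling may be exotic (= ¬SPC4); and for multi-cusped exteriors the simply connected fillings form infinite slabs (one short slope, the rest free: IRT Ex 4.8), so no finite census closes it without a uniform handle-calculus argument.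
sources: arXiv:math/0502293 Thm 4.4, Rem 4.5, Ex 4.8, arXiv:1503.07778, arXiv:math/0312436 §2, arXiv:math/0303260 §2.1, arXiv:1503.06722
[crux] 4D Property P on the Mostow-rigid stratum (card item X_hyp): for every smooth M (T2, 2nd
countable, ℝ⁴-charted, C^∞) presented as a torus surgery TLS(M,n,T,A) on a framed link of tori in S⁴
whose core-complement U = S⁴ ∖ ∪ T_i(S¹×S¹×0), with its smooth structure from S⁴, carries a complete
Riemannian metric of constant sectional curvature −1 (Literature PseudoRiemannianMetric.IsRiemannian
∧ HasConstantSectionalCurvature (−1) ∧ every Levi-Civita connection geodesically complete; finite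
volume deliberately not stated — no volume in the tree), M ≃ₕ S⁴ implies M ≅ S⁴ (C^∞ diffeomorphic).
Open instances: the Ivanšić–Ratcliffe–Tschantz fillings (math/0502293 Thm 4.4/Rem 4.5/Ex 4.8,
homeomorphic to S⁴, smooth type open); settled instance: canonical filling of M~1011 (Ivanšić;
Saratchandran arXiv:1503.07778). Engine: 2π theorem ⇒ only short-slab fillings qualify (support
LongFillingsNotSimplyConnected); canonical 24-cell Kirby diagrams (arXiv:1503.06722). Special case
of LinkSurgeryPropertyP (Sketch.lean `hyp_of_propertyP`). [difficulty: XL] -/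
@[route_item "route-SmoothPoincare4-HyperbolicTorusFillings"]
def HyperbolicFillingsStandard : Prop :=
  ∀ (M : Type) [TopologicalSpace M] [T2Space M] [SecondCountableTopology M] [ChartedSpace (EuclideanSpace ℝ (Fin 4)) M] [IsManifold (𝓡 4) ∞ M] (n : ℕ) (T : Fin n → (↥(Metric.sphere (0 : EuclideanSpace ℝ (Fin 2)) 1) × ↥(Metric.sphere (0 : EuclideanSpace ℝ (Fin 2)) 1)) × EuclideanSpace ℝ (Fin 2) → ↥(Metric.sphere (0 : EuclideanSpace ℝ (Fin 5)) 1)) (A : Fin n → Matrix (Fin 3) (Fin 3) ℤ), ((∀ i, Manifold.IsSmoothEmbedding (((𝓡 1).prod (𝓡 1)).prod 𝓘(ℝ, EuclideanSpace ℝ (Fin 2))) (𝓡 4) ∞ (T i)) ∧ Pairwise (fun i j => Disjoint (Set.range (T i)) (Set.range (T j))) ∧ (∀ i, (A i).det = 1 ∨ (A i).det = -1) ∧ ∃ (U : TopologicalSpace.Opens ↥(Metric.sphere (0 : EuclideanSpace ℝ (Fin 5)) 1)) (jA : ↥U → M) (jB : Fin n → (↥(Metric.sphere (0 : EuclideanSpace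 ℝ (Fin 2)) 1) × ↥(Metric.sphere (0 : EuclideanSpace ℝ (Fin 2)) 1)) × EuclideanSpace ℝ (Fin 2) → M), (U : Set ↥(Metric.sphere (0 : EuclideanSpace ℝ (Fin 5)) 1)) = (⋃ i, Set.range (fun x : (↥(Metric.sphere (0 : EuclideanSpace ℝ (Fin 2)) 1) × ↥(Metric.sphere (0 : EuclideanSpace ℝ (Fin 2)) 1)) => T i (x, 0)))ᶜ ∧ Manifold.IsSmoothEmbedding (𝓡 4) (𝓡 4) ∞ jA ∧ IsOpen (Set.range jA) ∧ (∀ i, Manifold.IsSmoothEmbedding (((𝓡 1).prod (𝓡 1)).prod 𝓘(ℝ, EuclideanSpace ℝ (Fin 2))) (𝓡 4) ∞ (jB i) ∧ IsOpen (Set.range (jB i))) ∧ Set.range jA ∪ (⋃ i, Set.range (jB i)) = Set.univ ∧ Pairwise (fun i j => Disjoint (Set.range (jB i)) (Set.range (jB j))) ∧ ∀ (i : Fin n) (a : ↥U) (b : (↥(Metric.sphere (0 : EuclideanSpace ℝ (Fin 2)) 1) × ↥(Metric.sphere (0 : EuclideanSpace ℝ (Fin 2)) 1)) × EuclideanSpace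 ℝ (Fin 2)), (jA a = jB i b ↔ ∃ θ₁ θ₂ θ₃ t : ℝ, 0 < t ∧ b = ((Literature.Topology.FourManifolds.circlePoint (θ₁), Literature.Topology.FourManifolds.circlePoint (θ₂)), t • ((Literature.Topology.FourManifolds.circlePoint (θ₃) : ↥(Metric.sphere (0 : EuclideanSpace ℝ (Fin 2)) 1)) : EuclideanSpace ℝ (Fin 2))) ∧ (a : ↥(Metric.sphere (0 : EuclideanSpace ℝ (Fin 5)) 1)) = T i ((Literature.Topology.FourManifolds.circlePoint ((A i 0 0 : ℝ) * θ₁ + (A i 0 1 : ℝ) * θ₂ + (A i 0 2 : ℝ) * θ₃), Literature.Topology.FourManifolds.circlePoint ((A i 1 0 : ℝ) * θ₁ + (A i 1 1 : ℝ) * θ₂ + (A i 1 2 : ℝ) * θ₃)), t • ((Literature.Topology.FourManifolds.circlePoint ((A i 2 0 : ℝ) * θ₁ + (A i 2 1 : ℝ) * θ₂ + (A i 2 2 : ℝ) * θ₃) : ↥(Metric.sphere (0 : EuclideanSpace ℝ (Fin 2)) 1)) : EuclideanSpace ℝ (Fin 2))))) → (∀ U : TopologicalSpace.Opens ↥(Metric.sphere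 (0 : EuclideanSpace ℝ (Fin 5)) 1), (U : Set ↥(Metric.sphere (0 : EuclideanSpace ℝ (Fin 5)) 1)) = (⋃ i, Set.range (fun x : (↥(Metric.sphere (0 : EuclideanSpace ℝ (Fin 2)) 1) × ↥(Metric.sphere (0 : EuclideanSpace ℝ (Fin 2)) 1)) => T i (x, 0)))ᶜ → ∃ g : Literature.Geometry.Lorentzian.PseudoRiemannianMetric (𝓡 4) ∞ (EuclideanSpace ℝ (Fin 4)) (TangentSpace (𝓡 4) : ↥U → Type _), g.IsRiemannian ∧ g.HasConstantSectionalCurvature (-1) ∧ ∀ cov, g.IsLeviCivita cov → Literature.Geometry.Lorentzian.IsGeodesicallyComplete cov) → ContinuousMap.HomotopyEquiv M ↥(Metric.sphere (0 : EuclideanSpace ℝ (Fin 5)) 1) → Nonempty (M ≃ₘ⟮𝓡 4, 𝓡 4⟯ ↥(Metric.sphere (0 : EuclideanSpace ℝ (Fin 5)) 1))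

/-- item stmt-SmoothPoincare4-3358 · crux · rank 3 · open · by planner
why it might fail: Baykur–Sunukjian sequences may be essential: a torus of a later round can meet the core torus of an earlier one with non-zero algebraic intersection, and Larson notes single-link surgeries miss some π₁ of (χ,σ)=(2,0) manifolds.
sources: arXiv:1502.06834 §1 Question 1, arXiv:1009.0514, doi:10.1017/s0305004116000876
[crux] G = Larson's Question 1 restricted to homotopy spheres: every smooth 4-manifold M (T2, 2nd
countable, ℝ⁴-charted, C^∞) with a homotopy equivalence M ≃ₕ S⁴ is a single simultaneous torus
surgery on S⁴: ∃ n, pairwise disjoint framed tubes T_i : (S¹×S¹)×ℝ² ↪ S⁴ (i < n) and A_i ∈ GL(3,ℤ)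
with TLS(M,n,T,A) (open smooth embeddings of the core-complement and of n copies of (S¹×S¹)×ℝ² into
M, jointly covering, glued along a = T_i(ψ_(A_i) b)). Baykur–Sunukjian give a SEQUENCE of torus
surgeries from S⁴ to any (χ,σ)=(2,0) manifold (arXiv:1009.0514, recalled in Larson §1); the crux
asks one round for homotopy spheres. n = 0 ⇒ M ≅ S⁴, so SPC4 ⇒ G. [difficulty: open-problem] -/
@[route_item "route-SmoothPoincare4-HyperbolicTorusFillings", crux]
def SingleLinkGeneration : Prop :=
  ∀ (M : Type) [TopologicalSpace M] [T2Space M] [SecondCountableTopology M] [ChartedSpace (EuclideanSpace ℝ (Fin 4)) M] [IsManifold (𝓡 4) ∞ M], ContinuousMap.HomotopyEquiv M ↥(Metric.sphere (0 : EuclideanSpace ℝ (Fin 5)) 1) → ∃ (n : ℕ) (T : Fin n → (↥(Metric.sphere (0 : EuclideanSpace ℝ (Fin 2)) 1) × ↥(Metric.sphere (0 : EuclideanSpace ℝ (Fin 2)) 1)) × EuclideanSpace ℝ (Fin 2) → ↥(Metric.sphere (0 : EuclideanSpace ℝ (Fin 5)) 1)) (A : Fin n → Matrix (Fin 3) (Fin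 3) ℤ), (∀ i, Manifold.IsSmoothEmbedding (((𝓡 1).prod (𝓡 1)).prod 𝓘(ℝ, EuclideanSpace ℝ (Fin 2))) (𝓡 4) ∞ (T i)) ∧ Pairwise (fun i j => Disjoint (Set.range (T i)) (Set.range (T j))) ∧ (∀ i, (A i).det = 1 ∨ (A i).det = -1) ∧ ∃ (U : TopologicalSpace.Opens ↥(Metric.sphere (0 : EuclideanSpace ℝ (Fin 5)) 1)) (jA : ↥U → M) (jB : Fin n → (↥(Metric.sphere (0 : EuclideanSpace ℝ (Fin 2)) 1) × ↥(Metric.sphere (0 : EuclideanSpace ℝ (Fin 2)) 1)) × EuclideanSpace ℝ (Fin 2) → M), (U : Set ↥(Metric.sphere (0 : EuclideanSpace ℝ (Fin 5)) 1)) = (⋃ i, Set.range (fun x : (↥(Metric.sphere (0 : EuclideanSpace ℝ (Fin 2)) 1) × ↥(Metric.sphere (0 : EuclideanSpace ℝ (Fin 2)) 1)) => T i (x, 0)))ᶜ ∧ Manifold.IsSmoothEmbedding (𝓡 4) (𝓡 4) ∞ jA ∧ IsOpen (Set.range jA) ∧ (∀ i, Manifold.IsSmoothEmbedding (((𝓡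 1).prod (𝓡 1)).prod 𝓘(ℝ, EuclideanSpace ℝ (Fin 2))) (𝓡 4) ∞ (jB i) ∧ IsOpen (Set.range (jB i))) ∧ Set.range jA ∪ (⋃ i, Set.range (jB i)) = Set.univ ∧ Pairwise (fun i j => Disjoint (Set.range (jB i)) (Set.range (jB j))) ∧ ∀ (i : Fin n) (a : ↥U) (b : (↥(Metric.sphere (0 : EuclideanSpace ℝ (Fin 2)) 1) × ↥(Metric.sphere (0 : EuclideanSpace ℝ (Fin 2)) 1)) × EuclideanSpace ℝ (Fin 2)), (jA a = jB i b ↔ ∃ θ₁ θ₂ θ₃ t : ℝ, 0 < t ∧ b = ((Literature.Topology.FourManifolds.circlePoint (θ₁), Literature.Topology.FourManifolds.circlePoint (θ₂)), t • ((Literature.Topology.FourManifolds.circlePoint (θ₃) : ↥(Metric.sphere (0 : EuclideanSpace ℝ (Fin 2)) 1)) : EuclideanSpace ℝ (Fin 2))) ∧ (a : ↥(Metric.sphere (0 : EuclideanSpace ℝ (Fin 5)) 1)) = T i ((Literature.Topology.FourManifolds.circlePoint ((A i 0 0 : ℝ) * θ₁ + (A i 0 1 : ℝ) * θ₂ + (A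 i 0 2 : ℝ) * θ₃), Literature.Topology.FourManifolds.circlePoint ((A i 1 0 : ℝ) * θ₁ + (A i 1 1 : ℝ) * θ₂ + (A i 1 2 : ℝ) * θ₃)), t • ((Literature.Topology.FourManifolds.circlePoint ((A i 2 0 : ℝ) * θ₁ + (A i 2 1 : ℝ) * θ₂ + (A i 2 2 : ℝ) * θ₃) : ↥(Metric.sphere (0 : EuclideanSpace ℝ (Fin 2)) 1)) : EuclideanSpace ℝ (Fin 2))))

/-- item stmt-SmoothPoincare4-3359 · crux · rank 4 · open · by planner
why it might fail: It contains the Gluck twist conjecture and all IRT candidates: a single exotic link surgery refutes it (and SPC4); off the hyperbolic and S¹-symmetric strata there is no engine at all (no geometrisation in dimension 4).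
sources: arXiv:1502.06834, doi:10.2140/pjm.1988.133.289, arXiv:math/0502293
[crux] P = four-dimensional Property P, link form: for every smooth M and every torus-link surgery
presentation TLS(M,n,T,A) on S⁴ (framed disjoint tubes T_i, matrices A_i ∈ GL(3,ℤ), open-gluing
witnesses jA, jB), M ≃ₕ S⁴ ⇒ Nonempty (M ≃ₘ S⁴). Contains the Gluck twist conjecture (Iwase 1988: a
Gluck twist is a torus surgery on a torus built from the 2-knot; cf. route GluckLasagna item
GlasGluckTwistConjecture) and every IRT hyperbolic-origin candidate; strata with an engine:
hyperbolic complement (rank 2), spun/twisted-spun tori (support SpunTorusSurgeries), unknotted torus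
(Larson §5: surgeries give S⁴, S¹×S³#S²×S², S¹×S³#S²×~S²). SPC4 ⇒ P. [deps: none] [difficulty:
open-problem] -/
@[route_item "route-SmoothPoincare4-HyperbolicTorusFillings", crux]
def LinkSurgeryPropertyP : Prop :=
  ∀ (M : Type) [TopologicalSpace M] [T2Space M] [SecondCountableTopology M] [ChartedSpace (EuclideanSpace ℝ (Fin 4)) M] [IsManifold (𝓡 4) ∞ M] (n : ℕ) (T : Fin n → (↥(Metric.sphere (0 : EuclideanSpace ℝ (Fin 2)) 1) × ↥(Metric.sphere (0 : EuclideanSpace ℝ (Fin 2)) 1)) × EuclideanSpace ℝ (Fin 2) → ↥(Metric.sphere (0 : EuclideanSpace ℝ (Fin 5)) 1)) (A : Fin n → Matrix (Fin 3) (Fin 3) ℤ), ((∀ i, Manifold.IsSmoothEmbedding (((𝓡 1).prod (𝓡 1)).prod 𝓘(ℝ, EuclideanSpace ℝ (Fin 2))) (𝓡 4) ∞ (T i)) ∧ Pairwise (fun i j => Disjoint (Set.range (T i)) (Set.range (T j))) ∧ (∀ i, (A i).det = 1 ∨ (A i).det = -1) ∧ ∃ (U : TopologicalSpace.Opens ↥(Metric.sphere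 (0 : EuclideanSpace ℝ (Fin 5)) 1)) (jA : ↥U → M) (jB : Fin n → (↥(Metric.sphere (0 : EuclideanSpace ℝ (Fin 2)) 1) × ↥(Metric.sphere (0 : EuclideanSpace ℝ (Fin 2)) 1)) × EuclideanSpace ℝ (Fin 2) → M), (U : Set ↥(Metric.sphere (0 : EuclideanSpace ℝ (Fin 5)) 1)) = (⋃ i, Set.range (fun x : (↥(Metric.sphere (0 : EuclideanSpace ℝ (Fin 2)) 1) × ↥(Metric.sphere (0 : EuclideanSpace ℝ (Fin 2)) 1)) => T i (x, 0)))ᶜ ∧ Manifold.IsSmoothEmbedding (𝓡 4) (𝓡 4) ∞ jA ∧ IsOpen (Set.range jA) ∧ (∀ i, Manifold.IsSmoothEmbedding (((𝓡 1).prod (𝓡 1)).prod 𝓘(ℝ, EuclideanSpace ℝ (Fin 2))) (𝓡 4) ∞ (jB i) ∧ IsOpen (Set.range (jB i))) ∧ Set.range jA ∪ (⋃ i, Set.range (jB i)) = Set.univ ∧ Pairwise (fun i j => Disjoint (Set.range (jB i)) (Set.range (jB j))) ∧ ∀ (i : Fin n) (a : ↥U) (b : (↥(Metric.sphere (0 :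 EuclideanSpace ℝ (Fin 2)) 1) × ↥(Metric.sphere (0 : EuclideanSpace ℝ (Fin 2)) 1)) × EuclideanSpace ℝ (Fin 2)), (jA a = jB i b ↔ ∃ θ₁ θ₂ θ₃ t : ℝ, 0 < t ∧ b = ((Literature.Topology.FourManifolds.circlePoint (θ₁), Literature.Topology.FourManifolds.circlePoint (θ₂)), t • ((Literature.Topology.FourManifolds.circlePoint (θ₃) : ↥(Metric.sphere (0 : EuclideanSpace ℝ (Fin 2)) 1)) : EuclideanSpace ℝ (Fin 2))) ∧ (a : ↥(Metric.sphere (0 : EuclideanSpace ℝ (Fin 5)) 1)) = T i ((Literature.Topology.FourManifolds.circlePoint ((A i 0 0 : ℝ) * θ₁ + (A i 0 1 : ℝ) * θ₂ + (A i 0 2 : ℝ) * θ₃), Literature.Topology.FourManifolds.circlePoint ((A i 1 0 : ℝ) * θ₁ + (A i 1 1 : ℝ) * θ₂ + (A i 1 2 : ℝ) * θ₃)), t • ((Literature.Topology.FourManifolds.circlePoint ((A i 2 0 : ℝ) * θ₁ + (A i 2 1 : ℝ) * θ₂ + (A i 2 2 : ℝ) * θ₃) : ↥(Metric.sphere (0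 : EuclideanSpace ℝ (Fin 2)) 1)) : EuclideanSpace ℝ (Fin 2))))) → ContinuousMap.HomotopyEquiv M ↥(Metric.sphere (0 : EuclideanSpace ℝ (Fin 5)) 1) → Nonempty (M ≃ₘ⟮𝓡 4, 𝓡 4⟯ ↥(Metric.sphere (0 : EuclideanSpace ℝ (Fin 5)) 1))

/-- item stmt-SmoothPoincare4-3360 · support · rank 9 · open · by planner
sources: arXiv:math/0502293, arXiv:math/0312436, arXiv:1503.06722
[support] Negative side (census supply): ¬HyperbolicFillingsStandard — some torus-link surgery on S⁴
with complete hyperbolic core-complement is homotopy equivalent but not diffeomorphic to S⁴ (⇒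
¬SPC4). Programme: enumerate short fillings of the Ratcliffe–Tschantz census double covers (IRT
math/0502293 Table 2; R–T math/0312436 §3 presentations), coset-enumerate π₁ = 1, attempt
standardisation on Saratchandran's diagrams; survivors are candidates with rigid coordinates (slopes
of a Mostow-rigid exterior). Bound by GaugeSum/Topological/Stable/HCobordismInvariant barriers:
needs an unstable detector. [difficulty: open-problem] -/
@[route_item "route-SmoothPoincare4-HyperbolicTorusFillings"]
def HyperbolicOriginExotic : Prop :=
  ¬ HyperbolicFillingsStandard

-- item stmt-SmoothPoincare4-3422 · support · rank 9 · open · by planner — informal only, no Lean statement yet: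
--   [support] INFORMAL (needs_definition: complete finite-volume hyperbolic metric with T³ cusp
--   cross-sections, maximal embedded cusp neighbourhoods, flat length of a slope). 2π consequence ('fake
--   4-spheres are exceptional fillings'): let E be a compact smooth 4-manifold whose interior carries a
--   complete finite-volume hyperbolic metric with cusp cross-sections flat 3-tori ∂E = T³_1 ⊔ … ⊔ T³_k
--   (e.g. E = S⁴ ∖ ν(T_1 ∪ … ∪ T_k) for Ivanšić's five tori, or any Ivanšić–Ratcliffe–Tschantz double
--   cover), and let M = E ∪_φ ⊔_i (T²×D²) be a Dehn filling with slopes s_i = φ_i(pt × ∂D²). If every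
--   s_i has flat

-- item stmt-SmoothPoincare4-3460 · support · rank 9 · open · by planner — informal only, no Lean statement yet:
--   [support] INFORMAL (needs_definition: IsTorusLinkSurgery / spun torus T_K; provable special case of
--   LinkSurgeryPropertyP on the S¹-symmetric stratum). For every knot K ⊂ S³ let T_K = K × S¹ ⊂ B³ × S¹
--   ⊂ S⁴ = B³×S¹ ∪_id S²×D² be the spun torus and T'_K the twisted spun torus (same K × S¹, with S²×D²
--   glued by the Gluck map ρ) (Larson arXiv:1502.06834 §3; the unknotted torus is T_unknot). CLAIM:
--   every torus surgery S⁴_{T_K}(p,a,b) or S⁴_{T'_K}(p,a,b) that is homotopy equivalent to S⁴ is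
--   diffeomorphic to S⁴. PROOF SKETCH (planner's, to be checked by the grounder): the rotation of the S¹
--   factor, (x,

/-- item stmt-SmoothPoincare4-3361 · assembly · rank 1 · open · by planner
sources: arXiv:1502.06834
[assembly] SingleLinkGeneration → LinkSurgeryPropertyP → SmoothPoincare4 (sibling decls by name; the
gate renders the assembly after the cruxes). Proof (checked in folder/Sketch.lean
`assembly_provable`, 3 lines): intro hG hX M _ _ _ _ _ he; obtain ⟨n, T, A, h⟩ := hG M he; exact hX
M n T A h he — SmoothPoincare4 unfolds to Literature.SPC4.SmoothPoincareConjectureFour.{0} = ∀ M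
[TopologicalSpace] [T2Space] [SecondCountableTopology] (_ : ChartedSpace ℝ⁴ M) (_ : IsManifold (𝓡 4)
∞ M), M ≃ₕ S⁴ → Nonempty (M ≃ₘ S⁴). Believed PROVABLE NOW. [deps: SingleLinkGeneration,
LinkSurgeryPropertyP] [difficulty: provable-now] -/
@[route_item "route-SmoothPoincare4-HyperbolicTorusFillings"]
def Assembly : Prop :=
  SingleLinkGeneration → LinkSurgeryPropertyP → SmoothPoincare4

/-! D-0027 §2.1 — DECIDING THEOREM (planner-authored via `route open/edit --closes-file`; by planner-rbadge-SmoothPoincare4-HyperbolicTorus-c5f820ad-g4-0 2026-08-15T16:14:13Z):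
its hypotheses are this route's items and its conclusion the sub-problem Statement (glue_lint), and it elaborates with this file. -/

@[closes "route-SmoothPoincare4-HyperbolicTorusFillings"] theorem closes (hG : SingleLinkGeneration) (hP : LinkSurgeryPropertyP) :
    _root_.SmoothPoincare4 := by
  unfold _root_.SmoothPoincare4 Literature.SPC4.SmoothPoincareConjectureFour
    ContinuousMap.HomotopyEquiv.NonemptyDiffeomorphSphere
  intro M _ _ _ _ _ he
  obtain ⟨n, T, A, h⟩ := hG M he
  exact hP M n T A h he

end Summit.SmoothPoincare4.SmoothPoincare4.Theses.HyperbolicTorusFillings
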